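import Summits.AtomisticToContinuum.HydrodynamicLimit.Theses.OneFlightGossipEngine
import Summits.AtomisticToContinuum.HydrodynamicLimit.Theorems.JParityClosureOddContactSymmetryGibbsInvariance
import Summits.AtomisticToContinuum.HydrodynamicLimit.Theorems.RelayRaceLocalityRestartPrincipleLineGlue
import Summits.AtomisticToContinuum.HydrodynamicLimit.Theorems.RelayRaceLocalityNearConstantShortTimeHLEntropyPrice
import Summits.AtomisticToContinuum.HydrodynamicLimit.Theorems.LambertianContactSwapSwapGapGibbsDomination

/-!
# Sketch for crux idea `gibbs-budget-coherence-bridge` (crux `ClampedTransferDock`, stmt-AtomisticToContinuum-16665)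

Planner `planner-cruxidea-stmt-AtomisticToContinuum-16665-1-0`, round 1, ideator 1 (2026-08-16).

§1 PROVED (sorry-free): the GLOBAL-GIBBS ENTROPY BUDGET is conserved along every hard-sphere flow and
prices equilibrium exponential moments / equilibrium rare events under the TRUE law at every time:
`klDiv_lawAt_globalGibbs`, `globalGibbsBudget_integral`, `globalGibbsBudget_event`.

§2 TYPED (conjecture-grade, elaborates): the EQUILIBRIUM large-deviation statement the bridge consumes,
`EquilibriumNonBlobCoherenceLD` (super-exponential IN THE WINDOW LENGTH `τ`: every rate `r` is reached), and
the shape of the reduction of the dock's child (ii) `CoherentSuprathermalContentVanishesW` (copied verbatim from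
`Cruxes/ClampedCurrentsDock/Lines/IdeatorTwoSketch.lean` §1) to it + `MesoDriftTails` (copied verbatim from
`Cruxes/ClampedCurrentsDock/IdeatorOneSketch.lean`) + `EnergyCurrentTails` (route decl): `BridgeReduction`.
-/

noncomputable section

namespace Summit.AtomisticToContinuum.HydrodynamicLimit.Cruxes.ClampedTransferDock.GibbsBudgetBridge

open scoped BigOperators ENNReal Classical
open MeasureTheory Set Filter InformationTheory
open Literature.MathematicalPhysics.KineticTheory Literature.Analysis.FluidPDE Literature.Analysis.FunctionSpaces
open Summit.AtomisticToContinuum.HydrodynamicLimit.Theses.OneFlightGossipEngine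
open Summit.AtomisticToContinuum.HydrodynamicLimit.Theorems

variable {σ : ℝ} {N : ℕ}

/-! ## §1 The global-Gibbs budget (PROVED) -/

/-- The homogeneous (global) Gibbs law of `N+1` hard spheres at reduced diameter `σ`: constant activity `ab`,
zero drift, constant temperature `θb` (canonical; the activity value is immaterial). -/
abbrev globalGibbs (σ ab θb : ℝ) (N : ℕ)
    (Φ : HardSphereFlow (Torus.geometry (Fin 3)) (hsDiameter σ N) (N + 1)) :
    Measure (Config (N + 1) (Fin 3) T3) :=
  localGibbsLaw σ (fun _ => ab) (fun _ => (0 : V3)) (fun _ => θb) N Φ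

/-- Stationarity: the law at time `s` of the global Gibbs law is the global Gibbs law
(tree theorem `map_flow_localGibbsLaw_const`). -/
theorem lawAt_globalGibbs (ab θb : ℝ)
    (Φ : HardSphereFlow (Torus.geometry (Fin 3)) (hsDiameter σ N) (N + 1)) (s : ℝ) :
    Φ.lawAt (globalGibbs σ ab θb N Φ) s = globalGibbs σ ab θb N Φ := by
  rw [HardSphereFlow.lawAt_eq]
  exact map_flow_localGibbsLaw_const σ ab θb 0 N Φ s

/-- **Liouville transports the relative entropy with respect to global Gibbs unchanged**: for every finite
Liouville-a.c. initial law `μ` and every time `s`, `KL((Φ_s)_* μ ‖ G_N) = KL(μ ‖ G_N)`. In particular the TRUE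
pre-shock law at time `s` has EXACTLY the relative entropy `KL(λ_N ‖ G_N) ≍ r₀ (N+1)` of the initial local Gibbs
law — a budget, not an estimate. -/
theorem klDiv_lawAt_globalGibbs (ab θb : ℝ)
    (Φ : HardSphereFlow (Torus.geometry (Fin 3)) (hsDiameter σ N) (N + 1))
    (μ : Measure (Config (N + 1) (Fin 3) T3)) [IsFiniteMeasure μ]
    (hμ : μ ≪ liouville (Torus.geometry (Fin 3)) (N + 1) (hsDiameter σ N))
    [IsFiniteMeasure (globalGibbs σ ab θb N Φ)] (s : ℝ) :
    klDiv (Φ.lawAt μ s) (globalGibbs σ ab θb N Φ) = klDiv μ (globalGibbs σ ab θb N Φ) := by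
  have h := RestartPrinciple.IsentropicRegibbsification.klDiv_lawAt_lawAt Φ μ (globalGibbs σ ab θb N Φ) hμ
    (RestartPrinciple.IsentropicRegibbsification.localGibbsLaw_ac σ _ _ _ N Φ) s
  rwa [lawAt_globalGibbs ab θb Φ s] at h

/-- **THE BRIDGE (Guo–Papanicolaou–Varadhan transfer with the global budget).** For a Liouville-a.c. initial
probability law `P` (the local Gibbs datum) with `KL(P ‖ G_N) < ∞`, every time `s`, every measurable nonnegative
phase-space functional `Y` (e.g. a kinetic-window functional of the trajectory issued from the point) with
`Y ∘ Φ_s` integrable, every `c > 0`: an EQUILIBRIUM exponential-moment bound `∫ e^{cY} dG_N ≤ e^κ` is paid under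
the TRUE law at time `s` with the INITIAL budget: `E_P[Y ∘ Φ_s] ≤ c⁻¹ (KL(P ‖ G_N) + κ)`. -/
theorem globalGibbsBudget_integral (ab θb : ℝ)
    (Φ : HardSphereFlow (Torus.geometry (Fin 3)) (hsDiameter σ N) (N + 1))
    (P : Measure (Config (N + 1) (Fin 3) T3)) [IsProbabilityMeasure P]
    (hP : P ≪ liouville (Torus.geometry (Fin 3)) (N + 1) (hsDiameter σ N))
    [IsProbabilityMeasure (globalGibbs σ ab θb N Φ)]
    (hfin : klDiv P (globalGibbs σ ab θb N Φ) ≠ ⊤) (s : ℝ)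
    {Y : Config (N + 1) (Fin 3) T3 → ℝ} (hY : Measurable Y) (hY0 : ∀ z, 0 ≤ Y z)
    (hint : Integrable (fun z => Y (Φ.flow s z)) P) {c κ : ℝ} (hc : 0 < c)
    (hmgf : ∫⁻ z, ENNReal.ofReal (Real.exp (c * Y z)) ∂(globalGibbs σ ab θb N Φ) ≤
      ENNReal.ofReal (Real.exp κ)) :
    ∫ z, Y (Φ.flow s z) ∂P ≤ c⁻¹ * ((klDiv P (globalGibbs σ ab θb N Φ)).toReal + κ) := by
  have hfin' : klDiv (Φ.lawAt P s) (globalGibbs σ ab θb N Φ) ≠ ⊤ := by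
    rwa [klDiv_lawAt_globalGibbs ab θb Φ P hP s]
  have h := NearConstantShortTimeHL.integral_comp_flow_le_klDiv_add_log_of_nonneg Φ P
    (globalGibbs σ ab θb N Φ) s hfin' hY hY0 hint hc hmgf
  rwa [klDiv_lawAt_globalGibbs ab θb Φ P hP s] at h

/-- **Event form of the bridge.** An EQUILIBRIUM event of probability `≤ e^{-K}` has TRUE-law probability at
every time `s` at most `(KL(P ‖ G_N) + log 2)/K`. With `KL(P ‖ G_N) ≤ r₀(N+1)`: an equilibrium large-deviation
upper bound with rate `r` per particle is paid under the true law with probability `≤ (r₀ + o(1))/r` — so every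
equilibrium estimate that is SUPER-EXPONENTIAL IN AN AUXILIARY PARAMETER (here: the window length `τ → ∞`), not
necessarily in `N`, transfers. -/
theorem globalGibbsBudget_event (ab θb : ℝ)
    (Φ : HardSphereFlow (Torus.geometry (Fin 3)) (hsDiameter σ N) (N + 1))
    (P : Measure (Config (N + 1) (Fin 3) T3)) [IsProbabilityMeasure P]
    (hP : P ≪ liouville (Torus.geometry (Fin 3)) (N + 1) (hsDiameter σ N))
    [IsProbabilityMeasure (globalGibbs σ ab θb N Φ)]
    (hfin : klDiv P (globalGibbs σ ab θb N Φ) ≠ ⊤) (s : ℝ)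
    {A : Set (Config (N + 1) (Fin 3) T3)} (hA : MeasurableSet A) {K : ℝ} (hK : 0 < K)
    (hGA : (globalGibbs σ ab θb N Φ) A ≤ ENNReal.ofReal (Real.exp (-K))) :
    (P ((Φ.flow s) ⁻¹' A)).toReal ≤ K⁻¹ * ((klDiv P (globalGibbs σ ab θb N Φ)).toReal + Real.log 2) := by
  set G := globalGibbs σ ab θb N Φ with hG
  -- the functional `Y = K · 𝟙_A`
  set Y : Config (N + 1) (Fin 3) T3 → ℝ := A.indicator (fun _ => K) with hY
  have hYm : Measurable Y := measurable_const.indicator hA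
  have hY0 : ∀ z, 0 ≤ Y z := fun z => by
    simp only [hY, Set.indicator_apply]; split_ifs <;> [exact hK.le; exact le_rfl]
  have hYle : ∀ z, Y z ≤ K := fun z => by
    simp only [hY, Set.indicator_apply]; split_ifs <;> [exact le_rfl; exact hK.le]
  -- `Y ∘ Φ_s` is bounded measurable, hence integrable under the probability measure `P`
  have hint : Integrable (fun z => Y (Φ.flow s z)) P := by
    refine (integrable_const K).mono' (hYm.comp (Φ.measurable_flow s)).aestronglyMeasurable
      (Eventually.of_forall fun z => ?_)
    rw [Real.norm_eq_abs, abs_of_nonneg (hY0 _)]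
    exact hYle _
  -- equilibrium exponential moment: `∫ e^{Y} dG = G(Aᶜ)·1 + G(A)·e^K ≤ 1 + 1 = 2`
  have hmgf : ∫⁻ z, ENNReal.ofReal (Real.exp (1 * Y z)) ∂G ≤ ENNReal.ofReal (Real.exp (Real.log 2)) := by
    have hptw : ∀ z, ENNReal.ofReal (Real.exp (1 * Y z)) ≤
        1 + A.indicator (fun _ => ENNReal.ofReal (Real.exp K)) z := by
      intro z
      by_cases hz : z ∈ A
      · simp only [hY, one_mul, Set.indicator_of_mem hz]
        exact le_add_self
      · simp only [hY, one_mul, Set.indicator_of_notMem hz, Real.exp_zero, ENNReal.ofReal_one, add_zero]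
        exact le_rfl
    calc ∫⁻ z, ENNReal.ofReal (Real.exp (1 * Y z)) ∂G
        ≤ ∫⁻ z, (1 + A.indicator (fun _ => ENNReal.ofReal (Real.exp K)) z) ∂G := lintegral_mono hptw
      _ = 1 + ENNReal.ofReal (Real.exp K) * G A := by
          rw [lintegral_add_left measurable_const, lintegral_const, measure_univ, mul_one,
            lintegral_indicator hA, setLIntegral_const]
      _ ≤ 1 + ENNReal.ofReal (Real.exp K) * ENNReal.ofReal (Real.exp (-K)) := by gcongr
      _ = ENNReal.ofReal (Real.exp (Real.log 2)) := by
          rw [← ENNReal.ofReal_mul (Real.exp_pos K).le, ← Real.exp_add, add_neg_cancel, Real.exp_zero,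
            ENNReal.ofReal_one, Real.exp_log two_pos]
          norm_num
  have h := globalGibbsBudget_integral ab θb Φ P hP hfin s hYm hY0 hint one_pos hmgf
  -- `∫ Y ∘ Φ_s dP = K · P(Φ_s⁻¹ A)`
  have hval : ∫ z, Y (Φ.flow s z) ∂P = K * (P ((Φ.flow s) ⁻¹' A)).toReal := by
    have : (fun z => Y (Φ.flow s z)) = ((Φ.flow s) ⁻¹' A).indicator (fun _ => K) := by
      funext z
      simp only [hY, Set.indicator_apply, Set.mem_preimage]
    rw [this, integral_indicator_const _ ((Φ.measurable_flow s) hA), smul_eq_mul, mul_comm]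
    rfl
  rw [hval, inv_one, one_mul] at h
  -- divide by `K > 0`
  have hKinv : 0 < K⁻¹ := inv_pos.mpr hK
  calc (P ((Φ.flow s) ⁻¹' A)).toReal = K⁻¹ * (K * (P ((Φ.flow s) ⁻¹' A)).toReal) := by
        rw [← mul_assoc, inv_mul_cancel₀ hK.ne', one_mul]
    _ ≤ K⁻¹ * ((klDiv P (globalGibbs σ ab θb N Φ)).toReal + Real.log 2) :=
        mul_le_mul_of_nonneg_left h hKinv.le

/-- **The bridge, end to end (PROVED from landed tree theorems): equilibrium rates are paid by the TRUE
pre-shock law with the FIXED initial budget.** For continuous positive local Gibbs profiles and `σ ≤ 1/2` there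
is `A ≥ 0` (the static budget `KL(λ_N ‖ G_N) ≤ A (N+1)` of `exists_localGibbsLaw_dominated`, `G_N` = homogeneous
Gibbs at unit activity and temperature) such that for EVERY `N`, flow, time `s`, measurable phase-space event `E`
and rate `r > 0`: `G_N(E) ≤ e^{−r(N+1)}` implies `λ_N(Φ_s ∈ E) ≤ (A(N+1) + log 2)/(r(N+1))`. So an equilibrium
large-deviation bound whose rate `r` can be made LARGE (super-exponential in an auxiliary parameter — for the
coherence child: the window length `τ`) makes the event negligible under the true law, uniformly in time; no
localisation, no a-priori entropy estimate along the evolution, no property of the true dynamics is used. -/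
theorem trueLaw_prob_le_of_equilibriumRate {a₀ θ₀ : T3 → ℝ} {u₀ : T3 → V3} (ha : Continuous a₀)
    (hθ : Continuous θ₀) (hu : Continuous u₀) (ha0 : ∀ x, 0 < a₀ x) (hθ0 : ∀ x, 0 < θ₀ x)
    (hσ2 : σ ≤ 1 / 2) :
    ∃ A : ℝ, 0 ≤ A ∧ ∀ (N : ℕ) (Φ : HardSphereFlow (Torus.geometry (Fin 3)) (hsDiameter σ N) (N + 1))
      (s : ℝ) (E : Set (Config (N + 1) (Fin 3) T3)), MeasurableSet E → ∀ r : ℝ, 0 < r →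
      globalGibbs σ 1 1 N Φ E ≤ ENNReal.ofReal (Real.exp (-(r * ((N : ℝ) + 1)))) →
      ((localGibbsLaw σ a₀ u₀ θ₀ N Φ) ((Φ.flow s) ⁻¹' E)).toReal ≤
        (r * ((N : ℝ) + 1))⁻¹ * (A * ((N : ℝ) + 1) + Real.log 2) := by
  obtain ⟨A, b, hA, _hb, H⟩ :=
    LambertianContactSwapSwapGapGibbsDomination.exists_localGibbsLaw_dominated ha hθ hu ha0 hθ0 hσ2
  refine ⟨A, hA, fun N Φ s E hE r hr hGE => ?_⟩
  have hKL := (H N Φ).2.2.1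
  haveI := isProbabilityMeasure_localGibbsLaw ha hθ hu ha0 hθ0 hσ2 N Φ
  haveI : IsProbabilityMeasure (globalGibbs σ 1 1 N Φ) :=
    isProbabilityMeasure_localGibbsLaw continuous_const continuous_const continuous_const
      (fun _ => one_pos) (fun _ => one_pos) hσ2 N Φ
  have hfin : klDiv (localGibbsLaw σ a₀ u₀ θ₀ N Φ) (globalGibbs σ 1 1 N Φ) ≠ ⊤ :=
    ne_top_of_le_ne_top ENNReal.ofReal_ne_top hKL
  have hrN : 0 < r * ((N : ℝ) + 1) := by positivity
  have h := globalGibbsBudget_event 1 1 Φ (localGibbsLaw σ a₀ u₀ θ₀ N Φ)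
    (RestartPrinciple.IsentropicRegibbsification.localGibbsLaw_ac σ _ _ _ N Φ) hfin s hE hrN hGE
  refine h.trans (mul_le_mul_of_nonneg_left (add_le_add ?_ le_rfl) (inv_nonneg.2 hrN.le))
  exact ENNReal.toReal_le_of_le_ofReal (by positivity) hKL

/-! ## §2 The statements of the line (TYPED; conjecture-grade marked) -/

/-! ### Verbatim copies (attributed) of the three existing statements the reduction quotes -/

/-- VERBATIM from `Cruxes/ClampedCurrentsDock/IdeatorOneSketch.lean` (card `drift-clamp-not-speed-clamp`):
number of particles within minimal-image distance `r` of particle `i`. -/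
def ballCount (r : ℝ) {N : ℕ} (z : Config (N + 1) (Fin 3) T3) (i : Fin (N + 1)) : ℕ :=
  (Finset.univ.filter (fun j : Fin (N + 1) => Torus.euclidDist (z j).1 (z i).1 ≤ r)).card

/-- VERBATIM (ibid.): empirical mean velocity of the ball of radius `r` around particle `i`. -/
def ballMeanVel (r : ℝ) {N : ℕ} (z : Config (N + 1) (Fin 3) T3) (i : Fin (N + 1)) : V3 :=
  ((ballCount r z i : ℝ)⁻¹) •
    ∑ j ∈ Finset.univ.filter (fun j : Fin (N + 1) => Torus.euclidDist (z j).1 (z i).1 ≤ r), (z j).2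

/-- VERBATIM (ibid.): particle `i` is DRIFT-BAD at levels `(κ, r₀, D₀)` against the velocity field `u₀` — some
ball around it of radius in `[κ (N+1)^{-1/3}, r₀]` has empirical mean velocity deviating from `u₀(x_i)` by more
than `D₀` (the Galilean blob / comoving droplet). -/
def DriftBad (κ r₀ D₀ : ℝ) (u₀ : T3 → V3) {N : ℕ} (z : Config (N + 1) (Fin 3) T3)
    (i : Fin (N + 1)) : Prop :=
  ∃ r : ℝ, κ * (((N : ℝ) + 1) ^ (-(1 / 3 : ℝ))) ≤ r ∧ r ≤ r₀ ∧
    D₀ < ‖ballMeanVel r z i - u₀ (z i).1‖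

/-- VERBATIM (ibid.) `MesoDriftTails`: the TRUE-LAW, STATIC, FIXED-LEVEL price of blobs — the cubic-weighted mass
of drift-bad particles vanishes as `N → ∞` then `κ → ∞`, at every fixed drift level `D₀`. CONJECTURE-GRADE
(the residue of this card: blobs cost `∝` their content under equilibrium, so no entropy budget excludes them). -/
def MesoDriftTails : Prop :=
  ∀ (a₀ θ₀ : T3 → ℝ) (u₀ : T3 → V3), Continuous a₀ → Continuous θ₀ → Continuous u₀ →
    (∀ x, 0 < a₀ x) → (∀ x, 0 < θ₀ x) →
    ∃ σ₀ : ℝ, 0 < σ₀ ∧ ∀ σ : ℝ, 0 < σ → σ < σ₀ →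
    ∀ (T : ℝ) (ρ θ : ℝ → T3 → ℝ) (u : ℝ → T3 → V3), IsHardSphereEulerSolution σ T ρ u θ →
    ∀ Φ : (N : ℕ) → HardSphereFlow (Torus.geometry (Fin 3)) (hsDiameter σ N) (N + 1),
      TendstoHydroFieldsAt (fun N => localGibbsLaw σ a₀ u₀ θ₀ N (Φ N)) Φ ρ u θ 0 →
      ∀ t ∈ Set.Ico 0 T, ∀ D₀ : ℝ, 0 < D₀ → ∀ r₀ : ℝ, 0 < r₀ → ∀ ε : ℝ, 0 < ε →
      ∃ κ₀ : ℝ, 0 < κ₀ ∧ ∀ κ : ℝ, κ₀ ≤ κ → ∃ N₀ : ℕ, ∀ N : ℕ, N₀ ≤ N → ∀ s ∈ Set.Icc 0 t,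
        ∫⁻ z, ENNReal.ofReal (((N : ℝ) + 1)⁻¹ * ∑ i : Fin (N + 1),
            (if DriftBad κ r₀ D₀ (u s) ((Φ N).flow s z) i then (1 : ℝ) else 0) *
              (1 + ‖((Φ N).flow s z i).2 - u s ((Φ N).flow s z i).1‖ ^ 3))
          ∂(localGibbsLaw σ a₀ u₀ θ₀ N (Φ N)) ≤ ENNReal.ofReal ε

/-- VERBATIM from `Cruxes/ClampedCurrentsDock/Lines/IdeatorTwoSketch.lean` §1 (S6′; = the requested split child
(ii) of THIS dock, per the item text): the weighted coherence input `CoherentSuprathermalContentVanishesW`. -/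
def CoherentSuprathermalContentVanishesW : Prop :=
  ∀ (a₀ θ₀ : T3 → ℝ) (u₀ : T3 → V3), Continuous a₀ → Continuous θ₀ → Continuous u₀ →
    (∀ x, 0 < a₀ x) → (∀ x, 0 < θ₀ x) →
    ∃ σ₀ : ℝ, 0 < σ₀ ∧ ∀ σ : ℝ, 0 < σ → σ < σ₀ →
    ∀ (T : ℝ) (ρ θ : ℝ → T3 → ℝ) (u : ℝ → T3 → V3), IsHardSphereEulerSolution σ T ρ u θ →
    ∀ Φ : (N : ℕ) → HardSphereFlow (Torus.geometry (Fin 3)) (hsDiameter σ N) (N + 1),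
    TendstoHydroFieldsAt (fun N => localGibbsLaw σ a₀ u₀ θ₀ N (Φ N)) Φ ρ u θ 0 →
    ∀ t ∈ Set.Ico 0 T, ∃ Kstar : ℝ, 0 < Kstar ∧
    ∀ R : ℝ → T3 → ℝ → ℝ, Measurable (fun p : ℝ × T3 × ℝ => R p.1 p.2.1 p.2.2) →
    (∀ s x s', s' ≤ Kstar ^ 2 → R s x s' = 0) → (∀ s x s', |R s x s'| ≤ |s'|) →
    ∀ η : ℝ, 0 < η → ∀ ε : ℝ, 0 < ε →
    ∃ τ₀ : ℝ, 0 < τ₀ ∧ ∀ τ : ℝ, τ₀ ≤ τ → ∃ N₀ : ℕ, ∀ N : ℕ, N₀ ≤ N → ∀ s ∈ Set.Icc 0 t,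
      (let w : ℝ := τ * ((N : ℝ) + 1) ^ (-(1 / 3 : ℝ))
       let P := localGibbsLaw σ a₀ u₀ θ₀ N (Φ N)
       let W := fun (i : Fin (N + 1)) (s r : ℝ) (z : Config (N + 1) (Fin 3) T3) =>
         ((Φ N).flow r z i).2 - u s ((Φ N).flow r z i).1
       let cub := fun (i : Fin (N + 1)) (s : ℝ) (z : Config (N + 1) (Fin 3) T3) =>
         w⁻¹ * ∫ r in s..(s + w), ‖W i s r z‖ ^ 3
       let cubHi := fun (i : Fin (N + 1)) (s : ℝ) (z : Config (N + 1) (Fin 3) T3) =>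
         w⁻¹ * ∫ r in s..(s + w), (if Kstar < ‖W i s r z‖ then ‖W i s r z‖ ^ 3 else 0)
       let qbar := fun (i : Fin (N + 1)) (s : ℝ) (z : Config (N + 1) (Fin 3) T3) =>
         w⁻¹ • ∫ r in s..(s + w), (R s ((Φ N).flow r z i).1 (‖W i s r z‖ ^ 2)) • W i s r z
       ∫⁻ z, ENNReal.ofReal (((N : ℝ) + 1)⁻¹ * ∑ i : Fin (N + 1),
              (if η * cub i s z < ‖qbar i s z‖ then cubHi i s z else 0)) ∂P ≤ ENNReal.ofReal ε)

/-! ### The NEW statement: the equilibrium large deviation the bridge consumes -/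

/-- **`EquilibriumNonBlobCoherenceLD` — CONJECTURE-GRADE (equilibrium dynamics; the card's one new input).**
Under the GLOBAL Gibbs law `G_N` (constant activity `ab`, zero drift, temperature `θb`; STATIONARY, so the window
may be taken at `[0, w]`, `w = τ (N+1)^{-1/3}`): measure peculiar velocities `W = v − u(x)` against an ARBITRARY
bounded Lipschitz field `u` and test coherence with an arbitrary bounded radial weight `R` vanishing below `K⋆²`
(the heart's S6′ test `‖w⁻¹∫ R(x,|W|²) W dr‖ > η · w⁻¹∫|W|³`); count, per particle, ONLY the cubic content
carried at speeds in `(K⋆, K]` and at times when the particle is NOT drift-bad (not inside a comoving mesoscopic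
ball — `DriftBad` relative to the same field `u`). CLAIM: for every target rate `r` the `G_N`-probability that the
particle average of this bounded (`≤ K³`) non-blob coherent content exceeds `δ` is `≤ e^{−r(N+1)}` once the
mesoscopic floor `κ`, then the window `τ`, then `N` are large — an equilibrium large-deviation upper bound that is
SUPER-EXPONENTIAL IN `τ` (coherence of a non-aggregated suprathermal carrier over `τ → ∞` mean free times costs a
void/grazing tube of entropy `≳ c·K⋆σ²τ`, a thin comoving needle `≳ c log τ` per member; aggregates thicker than
the floor are excluded by the non-blob indicator). WHY IT MIGHT FAIL: an equilibrium LD at scale `N` for a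
trajectory functional over `τ → ∞` mean free times at FIXED density is beyond print (Lanford-time barrier); thin
structures cheaper than needles. Thresholds depend on `u, R` only through `(U, L, K⋆, K, η, D₀, r₀)`. -/
def EquilibriumNonBlobCoherenceLD : Prop :=
  ∀ (ab θb : ℝ), 0 < ab → 0 < θb → ∃ σ₀ : ℝ, 0 < σ₀ ∧ ∀ σ : ℝ, 0 < σ → σ < σ₀ →
    ∀ Φ : (N : ℕ) → HardSphereFlow (Torus.geometry (Fin 3)) (hsDiameter σ N) (N + 1),
    ∀ (U L Kstar K η D₀ r₀ δ r : ℝ), 0 ≤ U → 0 ≤ L → 0 < Kstar → Kstar ≤ K → 0 < η → 0 < D₀ → 0 < r₀ →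
      0 < δ → 0 < r →
    ∃ κ₀ : ℝ, 0 < κ₀ ∧ ∀ κ : ℝ, κ₀ ≤ κ → ∃ τ₀ : ℝ, 0 < τ₀ ∧ ∀ τ : ℝ, τ₀ ≤ τ →
    ∃ N₀ : ℕ, ∀ N : ℕ, N₀ ≤ N →
    ∀ u : T3 → V3, Continuous u → (∀ x, ‖u x‖ ≤ U) → (∀ x y, ‖u x - u y‖ ≤ L * dist x y) →
    ∀ R : T3 → ℝ → ℝ, Measurable (fun p : T3 × ℝ => R p.1 p.2) →
      (∀ x s', s' ≤ Kstar ^ 2 → R x s' = 0) → (∀ x s', |R x s'| ≤ |s'|) →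
      (∀ x y s', |R x s' - R y s'| ≤ L * (1 + |s'|) * dist x y) →
      (let w : ℝ := τ * ((N : ℝ) + 1) ^ (-(1 / 3 : ℝ))
       let G := globalGibbs σ ab θb N (Φ N)
       let W := fun (i : Fin (N + 1)) (r : ℝ) (z : Config (N + 1) (Fin 3) T3) =>
         ((Φ N).flow r z i).2 - u ((Φ N).flow r z i).1
       let cub := fun (i : Fin (N + 1)) (z : Config (N + 1) (Fin 3) T3) =>
         w⁻¹ * ∫ r in (0 : ℝ)..w, ‖W i r z‖ ^ 3
       let Y := fun (i : Fin (N + 1)) (z : Config (N + 1) (Fin 3) T3) =>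
         w⁻¹ * ∫ r in (0 : ℝ)..w,
           (if Kstar < ‖W i r z‖ ∧ ‖W i r z‖ ≤ K ∧ ¬ DriftBad κ r₀ D₀ u ((Φ N).flow r z) i
            then ‖W i r z‖ ^ 3 else 0)
       let qbar := fun (i : Fin (N + 1)) (z : Config (N + 1) (Fin 3) T3) =>
         w⁻¹ • ∫ r in (0 : ℝ)..w, (R ((Φ N).flow r z i).1 (‖W i r z‖ ^ 2)) • W i r z
       G {z | δ < ((N : ℝ) + 1)⁻¹ * ∑ i : Fin (N + 1), (if η * cub i z < ‖qbar i z‖ then Y i z else 0)}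
         ≤ ENNReal.ofReal (Real.exp (-(r * ((N : ℝ) + 1)))))

/-- **The reduction the line would prove at crux-plan (M/L; real analysis + the three PROVED budget lemmas +
stationarity), stated:** child (ii) of the dock from the equilibrium LD, the static blob price and the cubic
tails. Chain, per window start `s` and particle `i`: split the sharp suprathermal content `cubHi` pointwise in
window time at speed `K = K(ε)` (above: `EnergyCurrentTails`, Fubini over the window) and by `DriftBad` at the
running configuration (drift-bad part `≤ K³ · 1{DriftBad}`: `MesoDriftTails` at each `r ∈ [s, s+w]`, averaged);
the remainder `Y_i ≤ K³` is the bounded non-blob content, and `E_λ[(N+1)⁻¹ Σ Y_i 1{coherent}] ≤ δ + K³ ·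
λ(Φ_s⁻¹ E_δ) ≤ δ + K³ (KL(λ_N ‖ G_N) + log 2)/(r (N+1))` by `globalGibbsBudget_event` + `EquilibriumNonBlobCoherenceLD`
(instance `u := u_s`, `R := R(s,·,·)`), with `KL(λ_N ‖ G_N) ≤ r₀ (N+1)` (static: bounded one-body log-ratio of the
local vs global Gibbs profiles + log-partition comparison) and `r := 3 K³ r₀ / ε`. -/
def BridgeReduction : Prop :=
  EquilibriumNonBlobCoherenceLD → MesoDriftTails → EnergyCurrentTails → CoherentSuprathermalContentVanishesW

end Summit.AtomisticToContinuum.HydrodynamicLimit.Cruxes.ClampedTransferDock.GibbsBudgetBridge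

end
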